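import Mathlib.Topology.Algebra.Order.Floor
import Mathlib.Algebra.Ring.Periodic
import Mathlib.Analysis.Convex.Segment
import Mathlib.Analysis.Normed.Module.Basic
import Mathlib.Geometry.Polygon.Basic
import HarnessLib

/-!
# Affine interpolation through a list of points and the closed polygon loop

A light leaf file (Mathlib imports only) for piecewise-affine curves through finitely many points
of a real vector space `E`:

* `affineInterp L : ℝ → E` — the piecewise-affine interpolation through the points of the list
  `L` with integer knots (`affineInterp L j = L[j]`, the segment `lineMap L[j] L[j+1]` on
  `[j, j + 1]`), continuous;
* `polygonLoop l : ℝ → E` — the **closed polygon** through the vertices `l`, `1`-periodic,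
  traversing the edge `v_k → v_{(k+1) % N}` during `[k/N, (k+1)/N]` (`N = l.length`); continuous,
  `polygonLoop l (k / N) = l[k]`, and its range is the union of the closed edges
  (`range_polygonLoop`), i.e. the `Polygon.boundary` of Mathlib's `Polygon E N` with these
  vertices (`range_polygonLoop_eq_boundary`).

It exists to serve `PolygonalDomains.lean` / `USTPeanoDomain.lean` (the lattice domains of the
uniform spanning tree Peano curve, [LSW04] §4.1, are insides of simple closed lattice polygons).

## Overlap with `Literature/Probability/Percolation` (for a librarian `refactor:` item)

The same interpolation already lives, with the SAME short names and statements, inside two heavy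
percolation files which this leaf deliberately does not import (they pull in the whole DKKMO
loop-ensemble stack): `Literature.Probability.Percolation.affineInterp`, `affineInterp_singleton`,
`affineInterp_cons_cons`, `affineInterp_cons_zero`, `continuous_affineInterp`
(`Percolation/LoopRotationInvarianceAssembly.lean`, ll. 424–522) and `affineInterp_eq_lineMap`,
`affineInterp_cons_cons_succ`, `affineInterp_natCast`, `getElem_append_take_one`,
`length_append_take_one`, `affineInterp_closed_eq_lineMap` (`Percolation/LoopRebasing.lean`,
ll. 48, 207–276). Those files can be retargeted to this one verbatim. New here: the `ℝ`-periodic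
loop `polygonLoop` (the percolation files use the `unitInterval`-curve `closedCurve` instead) and
its range / vertex / floor lemmas.

## Mathlib

`AffineMap.lineMap`, `segment`, `affineSegment_eq_segment`, `Int.fract`,
`ContinuousOn.comp_fract''`, `Continuous.if_le`; `Mathlib.Geometry.Polygon.Basic` has the bare
structure `Polygon P n` (vertices `Fin n → P`) with `Polygon.boundary` (union of the closed edges)
and `Polygon.HasNondegenerateEdges`, but no parametrised loop and no topology; we bridge to it in
`range_polygonLoop_eq_boundary`.
-/

noncomputable section

open Set Function

namespace Literature.Probability.RandomPlanarGeometry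

/-! ### Piecewise-affine interpolation -/

section Module

variable {E : Type*} [AddCommGroup E] [Module ℝ E]

/-- The **piecewise-affine interpolation** through the points of `l` with integer knots: on
`[k, k + 1]` it is the segment from `l[k]` to `l[k+1]` (affinely extended below `0` on the first
segment), constant equal to the last point after `length l - 1`. Junk `0` for `l = []`.
(Same definition as `Literature.Probability.Percolation.affineInterp`.) [folklore] -/
def affineInterp : List E → ℝ → E
  | [] => fun _ ↦ 0
  | [a] => fun _ ↦ a
  | a :: b :: l => fun s ↦ if s ≤ 1 then AffineMap.lineMap a b s else affineInterp (b :: l) (s - 1)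

/-- A one-point list interpolates to the constant. [folklore] -/
@[simp] theorem affineInterp_singleton (a : E) (s : ℝ) : affineInterp [a] s = a := rfl

/-- Unfolding `affineInterp` on a list with at least two points. [folklore] -/
theorem affineInterp_cons_cons (a b : E) (l : List E) (s : ℝ) :
    affineInterp (a :: b :: l) s =
      if s ≤ 1 then AffineMap.lineMap a b s else affineInterp (b :: l) (s - 1) := rfl

/-- `affineInterp (a :: l) 0 = a`. [folklore] -/
@[simp] theorem affineInterp_cons_zero (a : E) (l : List E) : affineInterp (a :: l) 0 = a := by
  cases l with
  | nil => rfl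
  | cons b l => simp [affineInterp_cons_cons]

/-- On `[j, j+1]` the affine interpolation through `L` is the segment from `L[j]` to `L[j+1]`.
[folklore] -/
theorem affineInterp_eq_lineMap (L : List E) (j : ℕ) (hj : j + 1 < L.length) {s : ℝ}
    (hs : s ∈ Icc (j : ℝ) (j + 1)) :
    affineInterp L s = AffineMap.lineMap (L[j]'(by omega)) (L[j + 1]'hj) (s - j) := by
  induction j generalizing L s with
  | zero =>
    obtain ⟨a, L', rfl⟩ := List.exists_cons_of_length_pos (by omega : 0 < L.length)
    obtain ⟨b, l, rfl⟩ := List.exists_cons_of_length_pos (by simpa using hj : 0 < L'.length)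
    simp only [Nat.cast_zero, zero_add] at hs
    rw [affineInterp_cons_cons, if_pos hs.2]
    simp
  | succ j ih =>
    obtain ⟨a, L', rfl⟩ := List.exists_cons_of_length_pos (by omega : 0 < L.length)
    obtain ⟨b, l, rfl⟩ := List.exists_cons_of_length_pos (by simp at hj; omega : 0 < L'.length)
    rw [affineInterp_cons_cons]
    push_cast at hs
    by_cases h1 : s ≤ 1
    · -- then `j = 0` and `s = 1`: the two adjacent segments agree at the knot
      have hj0 : j = 0 := by
        by_contra h
        have : (1 : ℝ) ≤ j := by exact_mod_cast Nat.one_le_iff_ne_zero.2 h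
        linarith [hs.1]
      subst hj0
      have hs1 : s = 1 := le_antisymm h1 (by simpa using hs.1)
      subst hs1
      rw [if_pos le_rfl]
      simp
    · rw [if_neg h1]
      have h' : j + 1 < (b :: l).length := by simp at hj ⊢; omega
      rw [ih (b :: l) h' ⟨by linarith [hs.1], by linarith [hs.2]⟩]
      simp only [List.getElem_cons_succ, Nat.cast_add, Nat.cast_one]
      congr 1
      ring

/-- Dropping the first segment: `affineInterp (a :: b :: l) (j + 1) = affineInterp (b :: l) j`.
[folklore] -/
theorem affineInterp_cons_cons_succ (a b : E) (l : List E) (j : ℕ) :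
    affineInterp (a :: b :: l) ((j : ℝ) + 1) = affineInterp (b :: l) j := by
  rw [affineInterp_cons_cons]
  rcases Nat.eq_zero_or_pos j with rfl | hj
  · simp
  · have : ¬ ((j : ℝ) + 1 ≤ 1) := by
      have : (1 : ℝ) ≤ j := by exact_mod_cast hj
      linarith
    rw [if_neg this, add_sub_cancel_right]

/-- At the integer knot `j` the affine interpolation passes through `L[j]`. [folklore] -/
theorem affineInterp_natCast :
    ∀ (L : List E) (j : ℕ) (hj : j < L.length), affineInterp L j = L[j]
  | [], j, hj => by simp at hj
  | [a], j, hj => by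
    have : j = 0 := by simpa using hj
    subst this; simp
  | a :: b :: l, 0, _ => by simp
  | a :: b :: l, j + 1, hj => by
    rw [Nat.cast_succ, affineInterp_cons_cons_succ,
      affineInterp_natCast (b :: l) j (by simpa using hj)]
    rfl

end Module

section Continuous

variable {E : Type*} [AddCommGroup E] [Module ℝ E] [TopologicalSpace E] [ContinuousAdd E]
  [ContinuousSMul ℝ E]

/-- `affineInterp l` is continuous (the affine pieces agree at the knots). [folklore] -/
theorem continuous_affineInterp : ∀ l : List E, Continuous (affineInterp l)
  | [] => continuous_const
  | [a] => continuous_const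
  | a :: b :: l => by
    change Continuous fun s ↦
      if s ≤ 1 then AffineMap.lineMap a b s else affineInterp (b :: l) (s - 1)
    have hseg : Continuous fun s : ℝ ↦ AffineMap.lineMap a b s := by
      simp only [AffineMap.lineMap_apply_module]; fun_prop
    refine Continuous.if_le hseg
      ((continuous_affineInterp (b :: l)).comp (continuous_sub_right 1))
      continuous_id continuous_const ?_
    rintro x rfl
    simp

end Continuous

/-! ### The closed polygon loop -/

section ListLemmas

variable {E : Type*}

/-- The vertex list of the closed polygon, read cyclically: `(pts ++ pts.take 1)[j] = pts[j % n]`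
for `j ≤ n = length pts`. [folklore] -/
theorem getElem_append_take_one {pts : List E} (hn : pts ≠ []) {j : ℕ} (hj : j ≤ pts.length) :
    (pts ++ pts.take 1)[j]'(by
      simp [List.length_take, Nat.min_eq_left (List.length_pos_iff.2 hn)]; omega) =
      pts[j % pts.length]'(Nat.mod_lt _ (List.length_pos_iff.2 hn)) := by
  have hn' : 0 < pts.length := List.length_pos_iff.2 hn
  rcases hj.lt_or_eq with hj' | rfl
  · rw [List.getElem_append_left hj']
    congr 1
    exact (Nat.mod_eq_of_lt hj').symm
  · rw [List.getElem_append_right le_rfl]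
    simp [Nat.mod_self]

/-- `length (pts ++ pts.take 1) = length pts + 1` for `pts ≠ []`. [folklore] -/
theorem length_append_take_one' {pts : List E} (hn : pts ≠ []) :
    (pts ++ pts.take 1).length = pts.length + 1 := by
  have hn' : 0 < pts.length := List.length_pos_iff.2 hn
  rw [List.length_append, List.length_take, Nat.min_eq_left (by omega)]

/-- Length bookkeeping: `length (pts ++ pts.take 1) - 1 = length pts` for `pts ≠ []` (real
form). [folklore] -/
theorem length_append_take_one {pts : List E} (hn : pts ≠ []) :
    (((pts ++ pts.take 1).length : ℝ) - 1) = pts.length := by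
  rw [length_append_take_one' hn]
  push_cast; ring

end ListLemmas

section Loop

variable {E : Type*} [AddCommGroup E] [Module ℝ E]

/-- **The closed polygon on its `j`-th edge** (`j < n`, cyclic indices): for `s ∈ [j, j + 1]`,
`affineInterp (pts ++ pts.take 1) s` is the point of parameter `s - j` on the segment from
`pts[j % n]` to `pts[(j + 1) % n]`. [folklore] -/
theorem affineInterp_closed_eq_lineMap {pts : List E} (hn : pts ≠ []) {j : ℕ}
    (hj : j < pts.length) {s : ℝ} (hs : s ∈ Icc (j : ℝ) (j + 1)) :
    affineInterp (pts ++ pts.take 1) s =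
      AffineMap.lineMap (pts[j % pts.length]'(Nat.mod_lt _ (List.length_pos_iff.2 hn)))
        (pts[(j + 1) % pts.length]'(Nat.mod_lt _ (List.length_pos_iff.2 hn))) (s - j) := by
  rw [affineInterp_eq_lineMap _ j (by rw [length_append_take_one' hn]; omega) hs,
    getElem_append_take_one hn hj.le, getElem_append_take_one hn (by omega)]

/-- The **closed polygon** through the vertices `l = [v₀, …, v_{N-1}]`: the `1`-periodic loop
`ℝ → E` which during `[k/N, (k+1)/N]` runs affinely from `v_k` to `v_{(k+1) % N}`. Junk constant
`0` for `l = []`. (The percolation files use the `unitInterval`-curve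
`Literature.Probability.Percolation.closedCurve pts = uniformCurve (pts ++ pts.take 1)` with the
same values on `[0, 1]`.) [folklore] -/
def polygonLoop (l : List E) (t : ℝ) : E :=
  affineInterp (l ++ l.take 1) (l.length * Int.fract t)

/-- The closed polygon is `1`-periodic. [folklore] -/
theorem periodic_polygonLoop (l : List E) : (polygonLoop l).Periodic 1 := fun t ↦ by
  simp [polygonLoop]

/-- On the fundamental period the loop is the interpolation of `l ++ l.take 1` at speed `N`.
[folklore] -/
theorem polygonLoop_of_mem_Ico (l : List E) {t : ℝ} (ht : t ∈ Ico (0 : ℝ) 1) :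
    polygonLoop l t = affineInterp (l ++ l.take 1) (l.length * t) := by
  rw [polygonLoop, Int.fract_eq_self.2 ⟨ht.1, ht.2⟩]

/-- The loop only depends on the fractional part of the time. [folklore] -/
theorem polygonLoop_fract (l : List E) (t : ℝ) :
    polygonLoop l (Int.fract t) = polygonLoop l t := by
  simp [polygonLoop]

/-- **Piece formula for the closed polygon**: for `k < N` and `θ ∈ [0, 1]`,
`polygonLoop l ((k + θ)/N) = lineMap v_k v_{(k+1) % N} θ`. [folklore] -/
theorem polygonLoop_apply_div {l : List E} {k : ℕ} (hk : k < l.length) {θ : ℝ}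
    (hθ : θ ∈ Icc (0 : ℝ) 1) :
    polygonLoop l ((k + θ) / l.length) =
      AffineMap.lineMap l[k] (l[(k + 1) % l.length]'(Nat.mod_lt _ (by omega))) θ := by
  have hl : l ≠ [] := List.ne_nil_of_length_pos (by omega)
  have hN : (0 : ℝ) < l.length := by exact_mod_cast (show 0 < l.length by omega)
  have hlen := length_append_take_one' hl
  -- the value of the un-wrapped interpolation
  have key : affineInterp (l ++ l.take 1) (k + θ) =
      AffineMap.lineMap l[k] (l[(k + 1) % l.length]'(Nat.mod_lt _ (by omega))) θ := by
    have e : l[k % l.length]'(Nat.mod_lt _ (by omega)) = l[k] :=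
      getElem_congr_idx (Nat.mod_eq_of_lt hk)
    rw [affineInterp_closed_eq_lineMap hl hk ⟨by linarith [hθ.1], by linarith [hθ.2]⟩,
      add_sub_cancel_left, e]
  have hle : ((k : ℝ) + θ) / l.length ≤ 1 := by
    rw [div_le_one hN]
    have : (k : ℝ) + 1 ≤ l.length := by exact_mod_cast hk
    linarith [hθ.2]
  rcases hle.lt_or_eq with hlt | heq
  · rw [polygonLoop_of_mem_Ico l ⟨div_nonneg (by linarith [hθ.1]) hN.le, hlt⟩,
      mul_div_cancel₀ _ hN.ne', key]
  · -- the wrap-around point `t = 1`: `k = N - 1`, `θ = 1`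
    have hθ1 : (k : ℝ) + θ = l.length := by rwa [div_eq_one_iff_eq hN.ne'] at heq
    have h0 : 0 < l.length := by omega
    rw [heq, (periodic_polygonLoop l).eq, polygonLoop_of_mem_Ico l ⟨le_rfl, one_pos⟩, mul_zero,
      ← key, hθ1, show (0 : ℝ) = ((0 : ℕ) : ℝ) by simp, affineInterp_natCast _ 0 (by omega),
      affineInterp_natCast _ _ (by omega), getElem_append_take_one hl le_rfl,
      getElem_append_take_one hl (Nat.zero_le _)]
    simp [Nat.mod_self]

/-- The closed polygon passes through its vertices: `polygonLoop l (k/N) = v_k`. [folklore] -/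
theorem polygonLoop_vertex {l : List E} {k : ℕ} (hk : k < l.length) :
    polygonLoop l (k / l.length) = l[k] := by
  simpa using polygonLoop_apply_div hk (θ := 0) ⟨le_rfl, zero_le_one⟩

/-- The point of the loop at time `t` lies on the edge number `k = ⌊N · fract t⌋`, at the affine
parameter `θ = N · fract t - k ∈ [0, 1)`. [folklore] -/
theorem polygonLoop_eq_of_floor {l : List E} (hl : l ≠ []) (t : ℝ) :
    ∃ (k : ℕ) (hk : k < l.length) (θ : ℝ), θ ∈ Ico (0 : ℝ) 1 ∧
      (k + θ) / l.length = Int.fract t ∧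
      polygonLoop l t = AffineMap.lineMap l[k] (l[(k + 1) % l.length]'(Nat.mod_lt _ (by omega))) θ := by
  have hN0 : 0 < l.length := List.length_pos_iff.2 hl
  have hN : (0 : ℝ) < l.length := by exact_mod_cast hN0
  set s : ℝ := l.length * Int.fract t with hs
  have hs0 : 0 ≤ s := mul_nonneg hN.le (Int.fract_nonneg t)
  have hsN : s < l.length := by
    have := Int.fract_lt_one t
    rw [hs]; nlinarith
  have hks : (⌊s⌋₊ : ℝ) ≤ s := Nat.floor_le hs0
  have hsk : s < ⌊s⌋₊ + 1 := Nat.lt_floor_add_one s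
  have hkN : ⌊s⌋₊ < l.length := (Nat.floor_lt hs0).2 hsN
  refine ⟨⌊s⌋₊, hkN, s - ⌊s⌋₊, ⟨by linarith, by linarith⟩, ?_, ?_⟩
  · rw [add_sub_cancel, hs, mul_div_cancel_left₀ _ hN.ne']
  · rw [← polygonLoop_apply_div hkN ⟨by linarith, by linarith⟩, add_sub_cancel, hs,
      mul_div_cancel_left₀ _ hN.ne', polygonLoop_fract]

/-- **The range of the closed polygon is the union of its closed edges.** [folklore] -/
theorem range_polygonLoop {l : List E} (hl : l ≠ []) :
    range (polygonLoop l) = ⋃ k : Fin l.length,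
      segment ℝ (l[(k : ℕ)]) (l[((k : ℕ) + 1) % l.length]'(Nat.mod_lt _ k.pos)) := by
  ext x
  simp only [mem_range, mem_iUnion]
  constructor
  · rintro ⟨t, rfl⟩
    obtain ⟨k, hk, θ, hθ, -, h⟩ := polygonLoop_eq_of_floor hl t
    refine ⟨⟨k, hk⟩, ?_⟩
    rw [segment_eq_image_lineMap, h]
    exact ⟨θ, ⟨hθ.1, hθ.2.le⟩, rfl⟩
  · rintro ⟨k, hx⟩
    rw [segment_eq_image_lineMap] at hx
    obtain ⟨θ, hθ, rfl⟩ := hx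
    exact ⟨_, polygonLoop_apply_div k.2 hθ⟩

/-- Every vertex lies on the closed polygon. [folklore] -/
theorem getElem_mem_range_polygonLoop {l : List E} {k : ℕ} (hk : k < l.length) :
    l[k] ∈ range (polygonLoop l) :=
  ⟨_, polygonLoop_vertex hk⟩

/-- `finRotate` adds one cyclically (value form). [folklore] -/
theorem val_finRotate_eq_mod {N : ℕ} (i : Fin N) :
    ((finRotate N i : Fin N) : ℕ) = ((i : ℕ) + 1) % N := by
  cases N with
  | zero => exact i.elim0
  | succ n =>
    rw [coe_finRotate]
    split_ifs with h
    · subst h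
      simp
    · have := Fin.val_lt_last h
      rw [Nat.mod_eq_of_lt (by omega)]

/-- **Bridge to Mathlib's `Polygon`**: the range of `polygonLoop l` is the `Polygon.boundary` (the
union of the closed edges `affineSegment ℝ vᵢ v_{finRotate i}`) of the polygon with vertices
`i ↦ l[i]`. [folklore] -/
theorem range_polygonLoop_eq_boundary {l : List E} (hl : l ≠ []) :
    range (polygonLoop l) =
      (⟨fun i : Fin l.length ↦ l[(i : ℕ)]⟩ : Polygon E l.length).boundary ℝ := by
  rw [range_polygonLoop hl]
  simp only [Polygon.boundary, Polygon.edgeSet, affineSegment_eq_segment]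
  refine iUnion_congr fun i ↦ ?_
  congr 1
  exact getElem_congr_idx (val_finRotate_eq_mod i).symm

end Loop

section LoopContinuous

variable {E : Type*} [AddCommGroup E] [Module ℝ E] [TopologicalSpace E] [ContinuousAdd E]
  [ContinuousSMul ℝ E]

/-- The closed polygon is continuous (it closes up: after one period it is back at `v₀`).
[folklore] -/
theorem continuous_polygonLoop (l : List E) : Continuous (polygonLoop l) := by
  rcases eq_or_ne l [] with rfl | hl
  · have : polygonLoop ([] : List E) = fun _ ↦ 0 := by
      funext t
      simp [polygonLoop]
      rfl
    rw [this]
    exact continuous_const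
  have hc : Continuous fun s : ℝ ↦ affineInterp (l ++ l.take 1) (l.length * s) :=
    (continuous_affineInterp _).comp (continuous_const.mul continuous_id)
  refine ContinuousOn.comp_fract'' hc.continuousOn ?_
  have hN := length_append_take_one' hl
  have h0 : 0 < l.length := List.length_pos_iff.2 hl
  simp only [mul_zero, mul_one]
  rw [show (0 : ℝ) = ((0 : ℕ) : ℝ) by simp, affineInterp_natCast _ 0 (by omega),
    affineInterp_natCast _ _ (by omega), getElem_append_take_one hl le_rfl,
    getElem_append_take_one hl (Nat.zero_le _)]
  simp [Nat.mod_self]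

end LoopContinuous

end Literature.Probability.RandomPlanarGeometry
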